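import Summits.CriticalPhenomena.CardyFormulaZ2.Theses.CardySelfRefinement
import Summits.CriticalPhenomena.CardyFormulaZ2.Theorems.CardySelfRefinementLagHandOffDiscretisable
import Summits.CriticalPhenomena.CardyFormulaZ2.Theorems.LagHandOff.Negative.Structure
import Summits.CriticalPhenomena.CardyFormulaZ2.Theorems.LagHandOff.Negative.KillTemplates
import Summits.CriticalPhenomena.CardyFormulaZ2.Theorems.LagHandOff.Negative.Guards
import Literature.Probability.RandomPlanarGeometry.SLEUniquenessInLaw
import Mathlib.MeasureTheory.Measure.HasOuterApproxClosed
import HarnessLib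

/-!
# Disproof of `SymmetryUpgradeR` (stmt-CriticalPhenomena-17239) — standing adversary, cycle 1

Crux (route `CardySelfRefinement`, rank 6; twin of `CardyRotToConf.CardyRotToConfR2SymmetryUpgradeR`,
stmt-17237):

  `∀ P, IsLocalMarkovChordalFamily P → (ii) P a.s. traces no boundary arc → (iii) interfaces of
   admissible discretisation families eventually a.e.-measurable → (iv) ∃ δs → 0⁺ along which, for
   EVERY Dobrushin domain D and EVERY admissible ℤ²-discretisation family E, the bond-ℤ² (p = ½)
   exploration interfaces converge in law to P D → ∀ D E, ZdDiscretisationFamily D E →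
   IsSLELaw 6 D (P D)`.

## FINDINGS (cycle 1, 2026-08-17) — NO KILL; the crux is PINNED

* **F1 (landed, `Theorems/SymmetryUpgradeR/Negative/LoadBearing.lean`, p133795).**
  - `clauseIII_holds`: hypothesis (iii) is a THEOREM (interfaces read finitely many edges) — decoration.
  - `symmetryUpgradeR_false_without_clauseIV`: delete (iv) (keep everything else, guard included) ⇒
    FALSE, by the stmt-0698 witness pair (chordal SLE₆ family vs its fat-germ one-shot surgery) +
    `stub_discretisable` + `IsSLELaw.unique'`.  ANY PROOF MUST USE (iv); the discretisability guard of
    the conclusion is cosmetic (`symmetryUpgradeR_iff_forall_domains`).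
  - `eq_of_isSeqLimitAlong` / `not_two_families_along_same_seq`: (iv) along a COMMON mesh sequence
    determines `P` on every domain ⇒ the two-family template of stmt-0698 (surgeries, germ rules,
    mixtures: `Cruxes/CardyRotToConfR2SymmetryUpgrade/Disproof.lean` §10–§14) is DEAD here.
  - `forall_eq_of_symmetryUpgradeR`: the crux IMPLIES uniqueness of admissible (LM + non-tracing)
    sequential limit families across DIFFERENT mesh sequences.
* **F2 (this file, §2).**  With (iv) present NO other hypothesis can be shown load-bearing by a
  counterexample: (iv) alone already pins `P D` for every `D` (every domain is admissibly
  discretised), so `¬(crux minus H)` for H ∈ {chordal, similarity, Markov, local, TI, non-tracing}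
  needs the same unavailable object as `¬crux` itself — the ℤ² interface limit.  Recorded as
  `pinned_of_clauseIV` + the reductions `not_without_iff`.
* **F3 (§3) What a refutation must be.**  `not_symmetryUpgradeR_iff`: ¬crux ⟺ ∃ P admissible,
  non-tracing, pinned along some δs, with `P D` not SLE₆ on some domain.  Two channels, both OPEN:
  R1 the pinned limit exists and is not SLE₆ somewhere (= a disproof of conformal invariance of
  critical bond-ℤ² percolation along a sequence); R2 (`symmetryUpgradeR_false_of_two_pinned`) two
  DISTINCT admissible pinned families along different sequences (an ultra-slow `log δ`-drift of the
  interface law — slower than any geometric sampling, so every limit point stays dilation invariant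
  and `ScaleInvariantLimits` does not exclude it).  Neither object is constructible; no `kit` toy can
  decide an `o(1)` statement; no finite model exists (the statement quantifies over laws on a Polish
  curve space pinned to an infinite-volume limit).
* **F4 (§4) Vacuity channels (crux TRUE for the wrong reason).**  `symmetryUpgradeR_of_no_pinned`:
  if NO admissible non-tracing family satisfies (iv), the crux holds vacuously.  (iv) for some P is
  exactly clause (ii) of `LagHandOff` along a full sequence; its standing adversary
  (`Theorems/LagHandOff/Negative/KillTemplates.lean`) lists the persistent lattice discrepancies
  that would kill it — E-blindness (`not_clauseIV_of_discrepancy` below), wiring-swap blindness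
  forced by `IsLocal` (`pinned_wiringSwap_blind`), moved-lattice incoherence — all CONSISTENT with
  an SLE₆ limit (self-duality at p = ½, reflection symmetry), none decidable by computation.
* **F5 (§5) Junk audit — all channels closed.**  Guard of the conclusion: decoration.  Mesh
  positivity / `δs → 0` inside (iv): dropping either only makes the hypotheses UNSATISFIABLE (a pin
  at mesh 0 is the Dirac mass at G02's junk constant curve `0`, `LagHandOff.Negative.Guards`, which
  no chordal family carries; a pin at constant mesh reads non-convergent data `E 1`), never the crux
  false.  Junk interfaces under ADMISSIBLE data: impossible — admissibility (arcs partition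
  `zdBoundary`, exactly two A–B edges each on one inner face) forces `e_a`, `e_b` onto the boundary
  of ONE face-component (parity of A/B switches along each boundary cycle), so the forward orbit of
  the turning rule from `e_a` ends at `e_b`: `existsUnique_medialExploration` is sound and the
  "junk-at-origin vs translation covariance" contradiction is unavailable.  `∀ E` → `∃ E` or
  canonical data in (iv): still pins (every D has an admissible E).  `IsSLELaw 6` is a genuine
  predicate (`isProjectiveLimit_preWienerMeasure_holds`; uniqueness `IsSLELaw.unique'`; existence
  `exists_isSLELaw_of_ne_eight`), so the conclusion is neither trivially true nor trivially false.
* **F6 (§6) Targets — picked line `SketchIdeatorTwo` (skeleton `Lines/SketchIdeatorTwo.lean`, six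
  registered stubs, glue `SymmetryUpgradeR_of` sorry-free — checked: rc 0, 6 sorries, all inside `stub_*`).**
  S1 `stub_conformalFront`, S2 `stub_reversible`, S3 `stub_touchExponent`, S5 `stub_cardyPinsSLE6`,
  S6 `stub_reflectionCovariant` all take clause (iv) ⇒ PINNED: by §2 no counterexample can reach them
  (a refutation of any of them is again "construct the ℤ² interface limit and show it lacks property X");
  they can only fail through an o(1) lattice statement (S2: wired/dual-wired rendering insensitivity;
  S6: none — the reflection is an exact symmetry; S3: the Ikhlef–Ponsaing transfer), none decidable by a
  `kit` toy.  S4 `stub_exitRigidity` is LATTICE-FREE (hyps: `IsLocalMarkovChordalFamily`, no-tracing,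
  `IsConformallyCovariant`, `IsIsometryCovariant`, `IsReversible`, touch exponent `1/3` in
  `(𝔻; 1, −1)` (marks `![0, 1/2]`, `arc 1` = lower half circle); conclusion Cardy on all conformal
  rectangles for `P (R.chord 0 2)` and `hitsBefore (R.arc 2) (R.arc 1)`, where
  `hitsBefore A B = mk '' {γ | ∃ t, γ t ∈ A ∧ ∀ s ≤ t, γ s ∉ B}` — a curve reaching `c` without touching
  either closed arc earlier counts as NOT hitting `(cd)` first; a null event for SLE₆-type laws).  Junk
  families do not inhabit S4's hypotheses: `tipFamily` fails chordality AND reversibility; `arcFamily`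
  fails no-tracing, locality, Markov and (for orientation-mismatched correspondences) conformal
  covariance; the hyperbolic-geodesic family passes conformal/isometry covariance, chordality,
  no-tracing, reversibility and the typed Markov property (the tail of a geodesic is the geodesic of
  the slit domain) but fails `IsLocal`, `IsTargetIndependent` AND the touch-exponent LOWER bound (the
  diameter never approaches the lower arc); SLE_κ, κ ≠ 6, fail the exponent (`8/κ − 1 ≠ 1/3`) and
  locality; SLE_κ(ρ) tuned to exponent `1/3` appear to fail the typed Markov clause (c) (the force point is not a
  function of (remaining domain, tip, target)), reversibility and locality.  So every hypothesis of S4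
  visibly works and no cheap counterexample exists; S4 is a genuine continuum rigidity statement
  (LSW hull-locality universality with the WEAK typed Markov property) — plausible, unproved, XL.
  Verdict on the line: no `stub-false`, no `stub-misstated`; the only soft spot is the one the lead
  names itself (S2 is not an exact lattice identity in the `bcBondConfig` rendering).
* **WHY IT RESISTS (one line).**  Clause (iv) makes `SymmetryUpgradeR` the identification half of
  conformal invariance for bond-ℤ² percolation GIVEN the existence of an admissible limit family:
  `¬crux` needs that family to exist and fail SLE₆, vacuity needs it not to exist — both are the
  open problem; every cheap channel (junk, guards, finite models, competitor families) is closed by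
  F1/F5.

Census of attacks: see NOTES.md `## Census` of the cdisprove folder.
-/

noncomputable section

open Set MeasureTheory Topology Filter Metric
open scoped unitInterval ENNReal NNReal

namespace Summit.CriticalPhenomena.CardyFormulaZ2.Cruxes.SymmetryUpgradeR.Disproof

open Literature.Probability.RandomPlanarGeometry Literature.Probability.LatticeModels
open Literature.Probability.Percolation
open Literature.Probability.RandomPlanarGeometry.ChordalFamily
open Summit.CriticalPhenomena.CardyFormulaZ2.Theses.CardySelfRefinement
open Summit.CriticalPhenomena.CardyFormulaZ2.Cruxes.LagHandOff.HittingTournament (stub_discretisable)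
open Summit.CriticalPhenomena.CardyFormulaZ2.Theorems.LagHandOff.Negative
  (lagHandOff_clause_i eq_of_isLocal_of_carrier_eq bondInterfaceIn_mesh_zero norm_pt_unitDisc)

/-! ## §1 The clauses, named; normal form -/

/-- Clause (ii): `P`-a.s. no non-trivial sub-arc of the curve lies in `∂D`. -/
def NonTracing (P : ChordalFamily) : Prop :=
  ∀ D : DobrushinDomain, ∀ᵐ γ ∂(P D), ∀ c : Curve ℂ, CurveClass.mk c = γ →
    ∀ s t : unitInterval, s < t → c '' Set.Icc s t ⊆ frontier D.carrier →
      (c '' Set.Icc s t).Subsingleton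

/-- Clause (iii) (a closed proposition — it does not mention `P`). -/
def ClauseIII : Prop :=
  ∀ (D : DobrushinDomain) (E : ℝ → DiscreteDobrushin), ZdDiscretisationFamily D E →
    ∀ᶠ δ in nhdsWithin (0 : ℝ) (Set.Ioi 0),
      AEMeasurable (Interface.bondInterfaceIn D (E δ)) (bondPercolation (zdGraph 2) half)

/-- `P` is the sequential scaling limit of the bond-ℤ² interfaces along `δs` (inner part of (iv)). -/
def IsSeqLimitAlong (δs : ℕ → ℝ) (P : ChordalFamily) : Prop :=
  ∀ (D : DobrushinDomain) (E : ℝ → DiscreteDobrushin), ZdDiscretisationFamily D E →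
    ∀ f : BoundedContinuousFunction (CurveClass ℂ) ℝ,
      Tendsto (fun n => ∫ ω, f (Interface.bondInterfaceIn D (E (δs n)) ω)
        ∂(bondPercolation (zdGraph 2) half)) atTop (𝓝 (∫ γ, f γ ∂(P D)))

/-- Clause (iv). -/
def ClauseIV (P : ChordalFamily) : Prop :=
  ∃ δs : ℕ → ℝ, (∀ n, 0 < δs n) ∧ Tendsto δs atTop (𝓝 0) ∧ IsSeqLimitAlong δs P

/-- The guarded conclusion. -/
def Conclusion (P : ChordalFamily) : Prop :=
  ∀ (D : DobrushinDomain) (E : ℝ → DiscreteDobrushin), ZdDiscretisationFamily D E →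
    IsSLELaw 6 D (P D)

/-- The crux, literally, in the named clauses. -/
theorem symmetryUpgradeR_iff :
    SymmetryUpgradeR ↔ ∀ P : ChordalFamily, IsLocalMarkovChordalFamily P → NonTracing P →
      ClauseIII → ClauseIV P → Conclusion P :=
  Iff.rfl

/-- (iii) is a theorem (landed: `Negative.clauseIII_holds`; source `lagHandOff_clause_i`). -/
theorem clauseIII_holds : ClauseIII := fun D E hE => lagHandOff_clause_i D E hE

/-- The guard is cosmetic: the conclusion is equivalent to `∀ D, IsSLELaw 6 D (P D)`. -/
theorem conclusion_iff (P : ChordalFamily) : Conclusion P ↔ ∀ D : DobrushinDomain, IsSLELaw 6 D (P D) :=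
  ⟨fun h D => by obtain ⟨E, hE⟩ := stub_discretisable D; exact h D E hE, fun h D _ _ => h D⟩

/-- NORMAL FORM: `crux ⟺ ∀ P, LM P → NT P → (iv) → ∀ D, IsSLELaw 6 D (P D)`. -/
theorem symmetryUpgradeR_iff_normal :
    SymmetryUpgradeR ↔ ∀ P : ChordalFamily, IsLocalMarkovChordalFamily P → NonTracing P →
      ClauseIV P → ∀ D : DobrushinDomain, IsSLELaw 6 D (P D) := by
  rw [symmetryUpgradeR_iff]
  refine ⟨fun h P hP hnt hiv => (conclusion_iff P).1 (h P hP hnt clauseIII_holds hiv),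
    fun h P hP hnt _ hiv => (conclusion_iff P).2 (h P hP hnt hiv)⟩

/-! ## §2 Pinning: with (iv) present, no other hypothesis is testable by counterexample -/

/-- PINNING (landed as `Negative.eq_of_isSeqLimitAlong`): along a common sequence, (iv) determines a
family of probability laws completely. -/
theorem pinned_of_isSeqLimitAlong {P₁ P₂ : ChordalFamily} {δs : ℕ → ℝ}
    (hp₁ : ∀ D : DobrushinDomain, IsProbabilityMeasure (P₁ D))
    (hp₂ : ∀ D : DobrushinDomain, IsProbabilityMeasure (P₂ D))
    (h₁ : IsSeqLimitAlong δs P₁) (h₂ : IsSeqLimitAlong δs P₂) : P₁ = P₂ := by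
  funext D
  obtain ⟨E, hE⟩ := stub_discretisable D
  haveI := hp₁ D
  haveI := hp₂ D
  exact ext_of_forall_integral_eq_of_IsFiniteMeasure fun f =>
    tendsto_nhds_unique (h₁ D E hE f) (h₂ D E hE f)

/-- F2, formal shadow.  For ANY property `Keep` of families (whatever sub-bundle of the typed axioms
one decides to keep), refuting "crux with the other axioms dropped" still requires a probability-law
family that IS a sequential limit of the ℤ² interfaces and is NOT SLE₆ somewhere — the same object a
refutation of the full crux needs (up to the kept axioms).  So hypothesis-dropping produces no
cheaper target than `¬crux` itself as long as (iv) stays. -/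
theorem not_without_iff (Keep : ChordalFamily → Prop) :
    (¬ ∀ P : ChordalFamily, Keep P → ClauseIV P → ∀ D : DobrushinDomain, IsSLELaw 6 D (P D)) ↔
      ∃ P : ChordalFamily, Keep P ∧ ClauseIV P ∧ ∃ D : DobrushinDomain, ¬ IsSLELaw 6 D (P D) := by
  constructor
  · intro h
    by_contra hne
    exact h fun P hK hiv D => by_contra fun hD => hne ⟨P, hK, hiv, D, hD⟩
  · rintro ⟨P, hK, hiv, D, hD⟩ h
    exact hD (h P hK hiv D)

/-! ## §3 What a refutation must be: the two open channels -/

/-- `¬crux`, unfolded: an admissible non-tracing PINNED family that is not SLE₆ on some domain. -/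
theorem not_symmetryUpgradeR_iff :
    ¬ SymmetryUpgradeR ↔ ∃ P : ChordalFamily, IsLocalMarkovChordalFamily P ∧ NonTracing P ∧
      ClauseIV P ∧ ∃ D : DobrushinDomain, ¬ IsSLELaw 6 D (P D) := by
  rw [symmetryUpgradeR_iff_normal]
  constructor
  · intro h
    by_contra hne
    exact h fun P hP hnt hiv D => by_contra fun hD => hne ⟨P, hP, hnt, hiv, D, hD⟩
  · rintro ⟨P, hP, hnt, hiv, D, hD⟩ h
    exact hD (h P hP hnt hiv D)

/-- CHANNEL R1 (template, OPEN): a pinned admissible family failing SLE₆ on ONE domain kills the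
crux — i.e. a disproof of conformal invariance of critical bond-ℤ² percolation along a sequence.
Not constructible (the object is the scaling limit itself); recorded, not filed. -/
theorem symmetryUpgradeR_false_of_pinned_nonSLE {P : ChordalFamily}
    (hP : IsLocalMarkovChordalFamily P) (hnt : NonTracing P) (hiv : ClauseIV P)
    {D : DobrushinDomain} (hD : ¬ IsSLELaw 6 D (P D)) : ¬ SymmetryUpgradeR :=
  not_symmetryUpgradeR_iff.2 ⟨P, hP, hnt, hiv, D, hD⟩

/-- CHANNEL R2 (template, OPEN): two DISTINCT admissible non-tracing pinned families (along possibly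
different mesh sequences) kill the crux, since both would be THE SLE₆ law everywhere
(`IsSLELaw.unique'`; landed positively as `Negative.forall_eq_of_symmetryUpgradeR`).  Physical
reading: non-uniqueness of the interface scaling limit through an ultra-slow drift in `log δ`
(e.g. a `sin log log δ⁻¹`-type dependence), invisible to dilation invariance of limit points. -/
theorem symmetryUpgradeR_false_of_two_pinned {P₁ P₂ : ChordalFamily}
    (hP₁ : IsLocalMarkovChordalFamily P₁) (n₁ : NonTracing P₁) (l₁ : ClauseIV P₁)
    (hP₂ : IsLocalMarkovChordalFamily P₂) (n₂ : NonTracing P₂) (l₂ : ClauseIV P₂)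
    (hne : P₁ ≠ P₂) : ¬ SymmetryUpgradeR := by
  intro h
  rw [symmetryUpgradeR_iff_normal] at h
  exact hne (funext fun D => (h P₁ hP₁ n₁ l₁ D).unique' (h P₂ hP₂ n₂ l₂ D))

/-- Along the SAME sequence channel R2 is void (pinning): two admissible families pinned along one
`δs` are equal.  So R2 genuinely needs two different sequences (non-uniqueness of the limit). -/
theorem two_pinned_same_seq_eq {P₁ P₂ : ChordalFamily} {δs : ℕ → ℝ}
    (hP₁ : IsLocalMarkovChordalFamily P₁) (hP₂ : IsLocalMarkovChordalFamily P₂)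
    (h₁ : IsSeqLimitAlong δs P₁) (h₂ : IsSeqLimitAlong δs P₂) : P₁ = P₂ :=
  pinned_of_isSeqLimitAlong (fun D => (hP₁.isChordal D).1) (fun D => (hP₂.isChordal D).1) h₁ h₂

/-! ## §4 Vacuity channels: the crux TRUE for the wrong reason -/

/-- V0: if no admissible non-tracing family is pinned, the crux holds vacuously.  "Some admissible
non-tracing family is pinned along a subsequence of every sequence" is clause (ii) of `LagHandOff`;
so a kill of `LagHandOff`-(ii) that works along EVERY sequence proves this crux for free (and breaks
the route one item earlier). -/
theorem symmetryUpgradeR_of_no_pinned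
    (h : ∀ P : ChordalFamily, IsLocalMarkovChordalFamily P → NonTracing P → ¬ ClauseIV P) :
    SymmetryUpgradeR :=
  symmetryUpgradeR_iff_normal.2 fun P hP hnt hiv _ => (h P hP hnt hiv).elim

/-- V1 — E-BLINDNESS is built into (iv): a pinned `P` gives the SAME limit to the interface
statistics of any two admissible families `E`, `E'` of one domain along `δs`.  Hence a persistent
discrepancy `∫ f(γ^{D,E}_{δₙ}) − ∫ f(γ^{D,E'}_{δₙ}) ↛ 0` along a sequence `δs` excludes every pin
along `δs` (template; the LagHandOff adversary's TEMPLATE 1, `not_lagHandOff_of_two_families`).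
Believed impossible (boundary-arm insensitivity to the o(1) freedom of admissible data). -/
theorem not_isSeqLimitAlong_of_discrepancy {δs : ℕ → ℝ} {D : DobrushinDomain}
    {E E' : ℝ → DiscreteDobrushin} (hE : ZdDiscretisationFamily D E) (hE' : ZdDiscretisationFamily D E')
    (f : BoundedContinuousFunction (CurveClass ℂ) ℝ)
    (h : ¬ Tendsto (fun n =>
        (∫ ω, f (Interface.bondInterfaceIn D (E (δs n)) ω) ∂(bondPercolation (zdGraph 2) half)) -
          ∫ ω, f (Interface.bondInterfaceIn D (E' (δs n)) ω) ∂(bondPercolation (zdGraph 2) half))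
      atTop (𝓝 0))
    (P : ChordalFamily) : ¬ IsSeqLimitAlong δs P := by
  intro hP
  have h12 := (hP D E hE f).sub (hP D E' hE' f)
  rw [sub_self] at h12
  exact h h12

/-- V2 — WIRING-SWAP BLINDNESS is forced on a pinned LOCAL family: `IsLocal` alone makes `P D = P D'`
for two Dobrushin structures with the same carrier and marked points (`eq_of_isLocal_of_carrier_eq`,
LagHandOff adversary), e.g. `D` and its orientation-reversed twin (arcs exchanged); (iv) pins `P D'`
to the limit of the interfaces WITH THE WIRING SWAPPED.  So a persistent difference between
`(ab)`-wired and `(ba)`-wired interface statistics of one carrier along `δs` excludes every LOCAL pin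
along `δs`.  On the lattice this is planar self-duality up to a half-mesh shift — believed true. -/
theorem pinned_wiringSwap_blind {P : ChordalFamily} (hP : P.IsLocal) {δs : ℕ → ℝ}
    (hpin : IsSeqLimitAlong δs P) {D D' : DobrushinDomain} (hc : D'.carrier = D.carrier)
    (h0 : D'.pt 0 = D.pt 0) (h1 : D'.pt 1 = D.pt 1)
    {E E' : ℝ → DiscreteDobrushin} (hE : ZdDiscretisationFamily D E) (hE' : ZdDiscretisationFamily D' E')
    (f : BoundedContinuousFunction (CurveClass ℂ) ℝ) :
    Tendsto (fun n =>
        (∫ ω, f (Interface.bondInterfaceIn D (E (δs n)) ω) ∂(bondPercolation (zdGraph 2) half)) -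
          ∫ ω, f (Interface.bondInterfaceIn D' (E' (δs n)) ω) ∂(bondPercolation (zdGraph 2) half))
      atTop (𝓝 0) := by
  have hDD' : P D' = P D := eq_of_isLocal_of_carrier_eq hP hc h0 h1
  have h12 := (hpin D E hE f).sub (hpin D' E' hE' f)
  rwa [hDD', sub_self] at h12

/-! ## §5 Junk audit (see the module docstring F5; the guard lemmas live in
`Theorems/LagHandOff/Negative/Guards.lean`: `bondInterfaceIn_mesh_zero`, `bondInterfaceIn_emptyData`) -/

/-- The mesh-positivity guard of (iv) is NOT load-bearing for this crux (contrast `LagHandOff`, where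
it sits in the conclusion): a pin WITHOUT it can use `δs ≡ 0`, where every interface is G02's junk
constant curve `0`, forcing `P D = δ_{[const 0]}` for all `D` — incompatible with chordality
(`a ≠ b`), so the weakened hypotheses are merely unsatisfiable and the weakened crux stays true.
Formal core: a family pinned at mesh zero is not chordal on the unit disc. -/
theorem not_isChordal_of_pinned_at_mesh_zero {P : ChordalFamily}
    (hpin : IsSeqLimitAlong (fun _ => (0 : ℝ)) P) : ¬ P.IsChordal := by
  intro hch
  -- at mesh 0 every interface is the constant curve 0
  have hconst : ∀ (D : DobrushinDomain) (E : ℝ → DiscreteDobrushin), ZdDiscretisationFamily D E →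
      ∀ ω, Interface.bondInterfaceIn D (E 0) ω = CurveClass.mk (Curve.const 0) :=
    fun D E hE ω => bondInterfaceIn_mesh_zero D (E 0) (hE.δ_eq 0) ω
  obtain ⟨E, hE⟩ := stub_discretisable DobrushinDomain.unitDisc
  haveI : IsProbabilityMeasure (P DobrushinDomain.unitDisc) := (hch DobrushinDomain.unitDisc).1
  -- hence `P unitDisc = δ_{[const 0]}`
  have hPD : P DobrushinDomain.unitDisc = Measure.dirac (CurveClass.mk (Curve.const (0 : ℂ))) := by
    refine ext_of_forall_integral_eq_of_IsFiniteMeasure fun f => ?_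
    have h1 := hpin DobrushinDomain.unitDisc E hE f
    simp only [hconst DobrushinDomain.unitDisc E hE, integral_const, smul_eq_mul, probReal_univ,
      one_mul] at h1
    rw [tendsto_nhds_unique h1 tendsto_const_nhds, integral_dirac]
  -- but chordal curves start at `a = unitDisc.pt 0`, of norm one
  have hsrc := (hch DobrushinDomain.unitDisc).2
  rw [hPD, ae_dirac_eq, eventually_pure] at hsrc
  have h0 : (CurveClass.mk (Curve.const (0 : ℂ))).source = 0 := by simp [Curve.source_def]
  have h1 := norm_pt_unitDisc 0
  rw [← hsrc.1, h0, norm_zero] at h1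
  exact zero_ne_one h1

end Summit.CriticalPhenomena.CardyFormulaZ2.Cruxes.SymmetryUpgradeR.Disproof

end
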